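import Mathlib
import HarnessLib
import Summits.HubbardSuperconductivity.HubbardSuperconductivity.Theorems.KLProgrammeKLRegimeSplitPhValueTransferWeighted

/-!
# Route `KLProgramme` — ENGINE (stmt-HubbardSuperconductivity-20437 `KLRegimeEngineV17F2`), row (c) binder #8 (★ v19 `hexLadMV`), the DIRECT p-h value row `RP` at every pinned pair,
# θ-RESOLVED AND TURNKEY IN THE NEAR-DIAGONAL REGIME: O6k-b with the transfer data `G_q`, `ε_q`, `d_q`, `N_sh` DISCHARGED by O6k-a / O6h-c — brick O6k-c
# (cell gate-hubbard-kl, seat hubbard-kl-k3c2-p2 g32, technique «thermal-bar induction n ≤ nScales β + 1 with EngineBoundsAtV4S sums»)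

WHY.  O6k-b `klph_directRow_transfer_le_weighted` bounds the rows door's `hP` at `(x, y)` by the diagonal object (window-profile moduli + rotation per angle, the two partner
values) plus `(Λₙ−Λₙ₊₁)·N_sh·(βL²)⁻¹·(128/3)Λ(t)⁻²·2·2·(2/Λ(t))·(d_q·G_q + ε_q)·F∞`, leaving the shifted rung `G_q`, the member-symbol shift `ε_q`, the band shift `d_q` and the
hard-shell count `N_sh` as data.  This file plugs in: `d_q = (4 + ‖K‖₁)·‖x − y‖_𝕋` (O6k-a `klph_bandShift_le`), and — in the NEAR-DIAGONAL regime `8d_q ≤ Λ(t)` — `G_q = 4/Λ(t)`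
(`klph_norm_propCT_mshift_le`), `ε_q = (128/Λ(t)²)·d_q·(2Λ(t) + d_q)` (`klph_memberSymbol_mshift_le`, member `Λ_j ≤ Λ(t)`), `N_sh ≤ (Λ(t)β/π + 1)(2200·4Λₙ·L² + 200000·L)`
(O6h-c `klph_card_hardShell_le`, `2¹⁵ ≤ L`, `1 ≤ n`).

* **`klph_directRow_transfer_le_weighted_regime`** — O6k-b's conclusion with these substitutions; the correction is
  `(Λₙ−Λₙ₊₁)(Λβ/π + 1)(2200·4Λₙ·L² + 200000·L)(βL²)⁻¹(128/3)Λ⁻²·2·2·(2/Λ)·(d_q·4/Λ + (128/Λ²)d_q(2Λ + d_q))·F∞` (`Λ = Λ(t)`), LINEAR in `d_q ∝ ‖x − y‖_𝕋` and ZERO at `y = x`.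
  By value (own digits, L → ∞, for the hands' x-read — not asserted by the theorem): `≤ 2^{31.6}·(1 + π/(βΛ(t)))·(d_q/Λ(t))·F∞` (2^{27.6} at `t = 0`, 2^{31.6} at `t = 1` where `Λₙ = 4Λ(t)`),
  to be compared by the consumer with the rows door's linear `phGain` slot `(KlamU)²·2¹⁰·ρ·4ⁿ/klE0` at `ρ = ‖x − y‖` (fits iff `(Klam/c₄)² ≳ 2^{26}` with `F∞ = (c₄U)²`).
  Remaining data = E1's only (as O6f′) + `F∞`.  Beyond the regime (`8d_q > Λ(t)`) the row is O6j's sign-blind bound.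
Pure composition; no definitions; nothing asserts (c), K3 or superconductivity.  [cite: BenfattoGiulianiMastropietro2006, §2.4–§2.5]
-/

noncomputable section

namespace Summit.HubbardSuperconductivity.HubbardSuperconductivity.Theorems.KLRegimeSplit

set_option linter.dupNamespace false -- summit = problem name (single-conjunct summit), D-0017

open Real Set Finset Literature.MathematicalPhysics.QuantumLattice
open Literature.Probability.LatticeModels hiding torusSupNorm
open Literature.MathematicalPhysics.QuantumLattice.BandSectorCounting
open Summit.HubbardSuperconductivity.HubbardSuperconductivity.Theorems.TwoPointAssembly
open Summit.HubbardSuperconductivity.HubbardSuperconductivity.Theorems.KLProgrammeLegKernels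
open Summit.HubbardSuperconductivity.HubbardSuperconductivity.Theorems.KLRegimeWick
open Summit.HubbardSuperconductivity.HubbardSuperconductivity.Theorems.EngineV8
open Summit.HubbardSuperconductivity.HubbardSuperconductivity.Theorems.DispersionFlow
open Summit.HubbardSuperconductivity.HubbardSuperconductivity.Theorems.PerturbedFermiCurve
open Summit.HubbardSuperconductivity.HubbardSuperconductivity.Theorems.C4a

variable {L M : ℕ} [NeZero L] [NeZero M]

section TransferRegime

variable {R : RenConsts} {U : ℝ} {N : ℕ}

/-- **THE DIRECT p-h ROW AT EVERY PINNED PAIR, θ-RESOLVED, TURNKEY IN THE NEAR-DIAGONAL REGIME** (module docstring): O6k-b with `d_q = (4 + ‖K‖₁)‖x − y‖_𝕋`,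
`G_q = 4/Λ(t)`, `ε_q = (128/Λ(t)²)d_q(2Λ(t) + d_q)`, `N_sh ≤ (Λ(t)β/π + 1)(2200·4Λₙ·L² + 200000·L)` (`8d_q ≤ Λ(t)`, `2¹⁵ ≤ L`, `1 ≤ n`).
[cite: BenfattoGiulianiMastropietro2006, §2.4–§2.5] -/
theorem klph_directRow_transfer_le_weighted_regime {β μ : ℝ} {K : TrigPolyC4v} (hK : FrameOK R U N μ K) (hβ : klBetaMin ≤ β) (hβL : β ≤ L)
    {a b : ℝ} (B : BandBounds a b) {A : ℝ} (hA : ∀ p : Momentum, ∀ j ≤ 2, ‖iteratedFDeriv ℝ j (frameShift K) p‖ ≤ A) (hADt : 2 * A < B.Dtmin)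
    {r : ℝ} (hlo : a < μ - r - A) (hhi : μ + r + A < b) (n : ℕ) {t : ℝ} (ht : t ∈ Icc (0 : ℝ) 1)
    (Φ : ℕ → ℝ → FreqMomentum L M → ℝ) (hΦ : Φ = fun j t k => (softSymbolCompl L M β μ K (n + 1) j) k + (hubbardCutoffWeightCT L M β μ K (klScale klE0 (n + 1)) k -
            hubbardCutoffWeightCT L M β μ K (klScale klE0 n + t * (klScale klE0 (n + 1) - klScale klE0 n)) k))
    (Wd : ℝ → FreqMomentum L M → ℝ) (hWd : Wd = fun t k => deriv (fun Λ' : ℝ => hubbardCutoffWeightCT L M β μ K Λ' k) (klScale klE0 n + t * (klScale klE0 (n + 1) - klScale klE0 n)))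
    {j : ℕ} (hj : n + 1 ≤ j) (hΛr : klScale klE0 n + t * (klScale klE0 (n + 1) - klScale klE0 n) < r)
    (hM : β * (klScale klE0 n + t * (klScale klE0 (n + 1) - klScale klE0 n)) / (2 * Real.pi) + 1 ≤ M)
    {Mg ℓ r₁ : ℝ} (hr₁ : 0 < r₁)
    (hbd : ∀ s, |klWd (klScale klE0 n + t * (klScale klE0 (n + 1) - klScale klE0 n)) s *
      klPhi (klScale klE0 j) (klScale klE0 n + t * (klScale klE0 (n + 1) - klScale klE0 n)) s| ≤ Mg)
    (hlip : ∀ s s', |klWd (klScale klE0 n + t * (klScale klE0 (n + 1) - klScale klE0 n)) s *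
        klPhi (klScale klE0 j) (klScale klE0 n + t * (klScale klE0 (n + 1) - klScale klE0 n)) s -
      klWd (klScale klE0 n + t * (klScale klE0 (n + 1) - klScale klE0 n)) s' *
        klPhi (klScale klE0 j) (klScale klE0 n + t * (klScale klE0 (n + 1) - klScale klE0 n)) s'| ≤ ℓ * |s - s'|)
    (hin : ∀ s, s ≤ r₁ ^ 2 → klWd (klScale klE0 n + t * (klScale klE0 (n + 1) - klScale klE0 n)) s *
      klPhi (klScale klE0 j) (klScale klE0 n + t * (klScale klE0 (n + 1) - klScale klE0 n)) s = 0)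
    (hout : ∀ s, (klScale klE0 n + t * (klScale klE0 (n + 1) - klScale klE0 n)) ^ 2 ≤ s →
      klWd (klScale klE0 n + t * (klScale klE0 (n + 1) - klScale klE0 n)) s *
        klPhi (klScale klE0 j) (klScale klE0 n + t * (klScale klE0 (n + 1) - klScale klE0 n)) s = 0)
    (F : FreqMomentum L M → Fin 2 → FreqMomentum L M → ℂ) (c : ℤ) (x y : TorusSite 2 L)
    -- the reference field and its window profile on the hard shell
    (V₀ : FreqMomentum L M → Fin 2 → ℂ) {ε : ℝ} (hε0 : 0 ≤ ε) {m : ℕ} (cen : Fin m → TorusSite 2 L) (ρw Aw : Fin m → ℝ) (hρw : ∀ w, 0 ≤ ρw w) (hAw : ∀ w, 0 ≤ Aw w)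
    (hδ : ∀ p : FreqMomentum L M, ∀ σ : Fin 2, Wd t p ≠ 0 →
      ‖(F (p.1, p.2 - (x - y)) σ p + F p σ (p.1, p.2 + (x - y))) - V₀ p σ‖ ≤ ε + ∑ w : Fin m, if klTorusNorm L (p.2 - cen w) ≤ ρw w then Aw w else 0)
    -- the angular weights of the reference field's spin sum
    (w₁ w₂ : ℝ × ℝ → ℝ) (v₁ v₂ : ℝ → ℝ) (hvm₁ : Measurable v₁) (hvm₂ : Measurable v₂) (hvp₁ : Function.Periodic v₁ (2 * π)) (hvp₂ : Function.Periodic v₂ (2 * π))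
    {Bv : ℝ} (hvb₁ : ∀ ϑ, |v₁ ϑ| ≤ Bv) (hvb₂ : ∀ ϑ, |v₂ ϑ| ≤ Bv)
    (hw₁ : ∀ p : ℝ × ℝ, p.1 ∈ Ioo (-r) r → w₁ (levelChart μ K p) = v₁ p.2) (hw₂ : ∀ p : ℝ × ℝ, p.1 ∈ Ioo (-r) r → w₂ (levelChart μ K p) = v₂ p.2)
    (hwc₁ : Continuous w₁) (hwc₂ : Continuous w₂) (hw1₁ : ∀ x y, w₁ (x + 2 * π, y) = w₁ (x, y)) (hw2₁ : ∀ x y, w₁ (x, y + 2 * π) = w₁ (x, y))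
    (hw1₂ : ∀ x y, w₂ (x + 2 * π, y) = w₂ (x, y)) (hw2₂ : ∀ x y, w₂ (x, y + 2 * π) = w₂ (x, y))
    {Lw Bw : ℝ} (hLw : 0 ≤ Lw) (hwlip₁ : ∀ p q : ℝ × ℝ, |w₁ p - w₁ q| ≤ Lw * dist p q) (hwlip₂ : ∀ p q : ℝ × ℝ, |w₂ p - w₂ q| ≤ Lw * dist p q)
    (hwb₁ : ∀ p, |w₁ p| ≤ Bw) (hwb₂ : ∀ p, |w₂ p| ≤ Bw)
    (hV : ∀ p : FreqMomentum L M, ∑ s : Fin 2, V₀ p s =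
      ((w₁ (latticeMomentum L p.2 0, latticeMomentum L p.2 1) : ℝ) : ℂ) + ((w₂ (latticeMomentum L p.2 0, latticeMomentum L p.2 1) : ℝ) : ℂ) * Complex.I)
    -- the partner kernels' sup on the hard shell, and the near-diagonal regime of the transfer `q = x − y`
    {Finf : ℝ} (hF0 : 0 ≤ Finf)
    (hF : ∀ p : FreqMomentum L M, ∀ σ : Fin 2, Wd t p ≠ 0 → ‖F (p.1, p.2 - (x - y)) σ p‖ ≤ Finf ∧ ‖F p σ (p.1, p.2 + (x - y))‖ ≤ Finf)
    (h8 : 8 * ((4 + K.coeffNorm 1) * klTorusNorm L (x - y)) ≤ klScale klE0 n + t * (klScale klE0 (n + 1) - klScale klE0 n)) (hL15 : (2 : ℝ) ^ 15 ≤ L) (hn1 : 1 ≤ n) :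
    (klScale klE0 n - klScale klE0 (n + 1)) * ((β * (L : ℝ) ^ 2) ^ 3)⁻¹ *
      ‖∑ p : FreqMomentum L M, ∑ σ : Fin 2, ∑ p' : FreqMomentum L M,
        (if matsubaraInt M p'.1 + c = matsubaraInt M p.1 + c ∧ p'.2 = p.2 + x - y then
          (((((Φ j t p) : ℝ) : ℂ) * (((β * (L : ℝ) ^ 2 : ℝ) : ℂ) * propCT L M β μ K p)) * ((((Wd t p') : ℝ) : ℂ) * (((β * (L : ℝ) ^ 2 : ℝ) : ℂ) * propCT L M β μ K p')) +
            ((((Wd t p) : ℝ) : ℂ) * (((β * (L : ℝ) ^ 2 : ℝ) : ℂ) * propCT L M β μ K p)) * ((((Φ j t p') : ℝ) : ℂ) * (((β * (L : ℝ) ^ 2 : ℝ) : ℂ) * propCT L M β μ K p'))) *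
            F p σ p'
        else 0)‖ ≤
      (klScale klE0 n - klScale klE0 (n + 1)) * (2 *
        (((2 * π) ^ 2)⁻¹ * (Bv * (2 * π * (π * Real.sqrt 2 / (B.Dtmin - 2 * A)) *
              ((2 * (klScale klE0 n + t * (klScale klE0 (n + 1) - klScale klE0 n)) * (2 * (klScale klE0 n + t * (klScale klE0 (n + 1) - klScale klE0 n)) *
                (2 * (klScale klE0 n + t * (klScale klE0 (n + 1) - klScale klE0 n)) ^ 2 * (ℓ / r₁ ^ 4 + 2 * Mg / r₁ ^ 6) + (ℓ / r₁ ^ 2 + Mg / r₁ ^ 4)))) *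
                ((klScale klE0 n + t * (klScale klE0 (n + 1) - klScale klE0 n)) + 2 * Real.pi / β) / β) +
            β⁻¹ * (((klScale klE0 n + t * (klScale klE0 (n + 1) - klScale klE0 n)) * β / π + 1) *
              (2 * (klScale klE0 n + t * (klScale klE0 (n + 1) - klScale klE0 n)) *
                (2 * π * (1 / (B.Dtmin - 2 * A) ^ 2 + Real.pi * Real.sqrt 2 * (2 + 4 * A) / (B.Dtmin - 2 * A) ^ 3) *
                  (klScale klE0 n + t * (klScale klE0 (n + 1) - klScale klE0 n)) * (Mg / r₁ ^ 2)))))) +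
          ((klScale klE0 n + t * (klScale klE0 (n + 1) - klScale klE0 n)) / π + 3 / β) *
            (2 * π * (Bw * (2 * (klScale klE0 n + t * (klScale klE0 (n + 1) - klScale klE0 n)) *
              (2 * (klScale klE0 n + t * (klScale klE0 (n + 1) - klScale klE0 n)) ^ 2 * (ℓ / r₁ ^ 4 + 2 * Mg / r₁ ^ 6) + (ℓ / r₁ ^ 2 + Mg / r₁ ^ 4)) *
              (4 + 2 * A)) + Lw * (Mg / r₁ ^ 2)) / L))) +
        ((2 : ℝ) ^ 10 * 15367 * ε + ∑ w : Fin m, (2 : ℝ) ^ 10 * 15381 * (ρw w / π + ((L : ℝ))⁻¹) * Aw w) +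
        (klScale klE0 n - klScale klE0 (n + 1)) *
            (((klScale klE0 n + t * (klScale klE0 (n + 1) - klScale klE0 n)) * β / π + 1) * (2200 * (4 * klScale klE0 n) * (L : ℝ) ^ 2 + 200000 * L)) * (β * (L : ℝ) ^ 2)⁻¹ *
          ((128 / 3 / (klScale klE0 n + t * (klScale klE0 (n + 1) - klScale klE0 n)) ^ 2) *
            (2 * (2 * ((2 / (klScale klE0 n + t * (klScale klE0 (n + 1) - klScale klE0 n))) *
              (((4 + K.coeffNorm 1) * klTorusNorm L (x - y)) * (4 / (klScale klE0 n + t * (klScale klE0 (n + 1) - klScale klE0 n))) + 128 / (klScale klE0 n + t * (klScale klE0 (n + 1) - klScale klE0 n)) ^ 2 * (((4 + K.coeffNorm 1) * klTorusNorm L (x - y)) * (2 * (klScale klE0 n + t * (klScale klE0 (n + 1) - klScale klE0 n)) + ((4 + K.coeffNorm 1) * klTorusNorm L (x - y)))))) * Finf))) := by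
  have hβ0 : 0 < β := pos_of_klBetaMin_le hβ
  have hL : (0 : ℝ) < L := hβ0.trans_le hβL
  have hβL2 : 0 < β * (L : ℝ) ^ 2 := by positivity
  have h10 := (klmf_klScale_succ_pos_le n).2
  have h1 := (klmf_klScale_succ_pos_le n).1
  have hmem := klws_affine_mem_Icc h10 ht
  set Λt : ℝ := klScale klE0 n + t * (klScale klE0 (n + 1) - klScale klE0 n) with hΛt_def
  have hΛt : 0 < Λt := h1.trans_le hmem.1
  have hdiff : 0 ≤ klScale klE0 n - klScale klE0 (n + 1) := by linarith
  set dq : ℝ := (4 + K.coeffNorm 1) * klTorusNorm L (x - y) with hdq_def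
  have hdq0 : 0 ≤ dq := by
    have h1' : 0 ≤ K.coeffNorm 1 := TrigPolyC4v.coeffNorm_nonneg 1 K
    have h2' : 0 ≤ klTorusNorm L (x - y) := torusSupNorm_nonneg _
    positivity
  -- the data of O6k-b from O6k-a
  have hdq : ∀ k : TorusSite 2 L, |nambuXiCT L μ K (k - (x - y)) - nambuXiCT L μ K k| ≤ dq ∧ |nambuXiCT L μ K (k + (x - y)) - nambuXiCT L μ K k| ≤ dq :=
    fun k => ⟨(klph_bandShift_le (L := L) μ K k (x - y)).2, (klph_bandShift_le (L := L) μ K k (x - y)).1⟩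
  have hG : ∀ p : FreqMomentum L M, Wd t p ≠ 0 → ‖propCT L M β μ K (p.1, p.2 - (x - y))‖ ≤ 4 / Λt ∧ ‖propCT L M β μ K (p.1, p.2 + (x - y))‖ ≤ 4 / Λt := by
    intro p hp
    rw [hWd] at hp
    exact ⟨klph_norm_propCT_mshift_le β μ K hΛt hp (hdq p.2).1 h8, klph_norm_propCT_mshift_le β μ K hΛt hp (hdq p.2).2 h8⟩
  have hΛj : 0 < klScale klE0 j := klth_klScale_pos j
  have hE0 : (0 : ℝ) ≤ klE0 := by norm_num [klE0]
  have hjle : klScale klE0 j ≤ Λt := (EngineV8.klScale_le_klScale hE0 hj).trans hmem.1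
  have hε : ∀ p : FreqMomentum L M, Wd t p ≠ 0 →
      |Φ j t (p.1, p.2 - (x - y)) - Φ j t p| ≤ 128 / Λt ^ 2 * (dq * (2 * Λt + dq)) ∧
        |Φ j t (p.1, p.2 + (x - y)) - Φ j t p| ≤ 128 / Λt ^ 2 * (dq * (2 * Λt + dq)) := by
    intro p hp
    rw [hWd] at hp
    rw [hΦ]
    exact ⟨klph_memberSymbol_mshift_le β μ K n j hΛj hjle hp hdq0 (hdq p.2).1 h8,
      klph_memberSymbol_mshift_le β μ K n j hΛj hjle hp hdq0 (hdq p.2).2 h8⟩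
  have hmain := klph_directRow_transfer_le_weighted (L := L) (M := M) hK hβ hβL B hA hADt hlo hhi n ht Φ hΦ Wd hWd hj hΛr hM hr₁ hbd hlip hin hout
    F c x y V₀ hε0 cen ρw Aw hρw hAw hδ w₁ w₂ v₁ v₂ hvm₁ hvm₂ hvp₁ hvp₂ hvb₁ hvb₂ hw₁ hw₂ hwc₁ hwc₂ hw1₁ hw2₁ hw1₂ hw2₂ hLw hwlip₁ hwlip₂ hwb₁ hwb₂ hV
    hF0 (by positivity : (0 : ℝ) ≤ 4 / Λt) (by positivity : (0 : ℝ) ≤ 128 / Λt ^ 2 * (dq * (2 * Λt + dq))) hdq0 hF hG hdq hε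
  -- the count
  have hcard : ((univ.filter fun p : FreqMomentum L M => Wd t p ≠ 0).card : ℝ) ≤ (Λt * β / π + 1) * (2200 * (4 * klScale klE0 n) * (L : ℝ) ^ 2 + 200000 * L) := by
    have h := klph_card_hardShell_le (L := L) (M := M) hK hL15 hβ0 hn1 hΛt hmem.2
    rw [hWd]
    exact h
  have hrest : 0 ≤ (β * (L : ℝ) ^ 2)⁻¹ * ((128 / 3 / Λt ^ 2) * (2 * (2 * ((2 / Λt) * (dq * (4 / Λt) + 128 / Λt ^ 2 * (dq * (2 * Λt + dq)))) * Finf))) := by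
    positivity
  have hmono : (klScale klE0 n - klScale klE0 (n + 1)) * ((univ.filter fun p : FreqMomentum L M => Wd t p ≠ 0).card : ℝ) * (β * (L : ℝ) ^ 2)⁻¹ *
        ((128 / 3 / Λt ^ 2) * (2 * (2 * ((2 / Λt) * (dq * (4 / Λt) + 128 / Λt ^ 2 * (dq * (2 * Λt + dq)))) * Finf))) ≤
      (klScale klE0 n - klScale klE0 (n + 1)) * ((Λt * β / π + 1) * (2200 * (4 * klScale klE0 n) * (L : ℝ) ^ 2 + 200000 * L)) * (β * (L : ℝ) ^ 2)⁻¹ *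
        ((128 / 3 / Λt ^ 2) * (2 * (2 * ((2 / Λt) * (dq * (4 / Λt) + 128 / Λt ^ 2 * (dq * (2 * Λt + dq)))) * Finf))) := by
    have := mul_le_mul_of_nonneg_left hcard hdiff
    have := mul_le_mul_of_nonneg_right this hrest
    simpa only [mul_assoc] using this
  linarith

end TransferRegime

end Summit.HubbardSuperconductivity.HubbardSuperconductivity.Theorems.KLRegimeSplit

end
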